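import Summits.CriticalPhenomena.PercolationContinuityZ3.Theorems.PercNearOneGluingNoHeavyPcintOSMCompute
import Literature.Probability.Percolation.HypercubicAxisGrouping
import HarnessLib

/-!
# PCINT lane, PHASE 4 (kernel second-moment oriented route): the cell `p_c^bond(ℤ^5) ≤ 0.2201`

Cell `prim-pcint`, seat `prim-pcint-1` (gen 13); memo `run/shared/lean/prim/pcint/T-FIBRE-ROUTE.md` §PHASE 4.

Cox–Durrett's second-moment bound for oriented percolation [Cox–Durrett 1983, (2.1)] as a theorem of the tree
(`OSM.criticalProb_le_of_green`): `p_c^bond(ℤ^5) ≤ G⁺/(5 + G⁺)` with the kernel-certified Green's-function bound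
`G⁺ = OSM.GplusQ 5 25` (exact partial sum `Σ_{k<125} u_k` by the row recursion `OSM.vrow` + the closed-form tail
`5·B(25)·26²/25`, `OSM.sum_u_le_Gplus`), checked by `decide +kernel` in exact rational arithmetic (`OSM.checkOSM`).
UNCONDITIONAL; below the GPS 2026 Table 1 value and below the lane's PHASE-3 fibre cell for `d = 5`.
-/

noncomputable section

namespace Summit.CriticalPhenomena.PercolationContinuityZ3.Theorems.Pcint.OSM

open Literature.Probability.Percolation Literature.Probability.LatticeModels

/-- **The kernel check for `ℤ^5`**: `GplusQ 5 25 · (10⁴ − 2201) ≤ 2201 · 5` in exact rational arithmetic. -/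
theorem checkOSM_5 : checkOSM 5 25 2201 = true := by decide +kernel

/-- **`p_c^bond(ℤ^5) ≤ 0.2201`** (second-moment oriented route, Cox–Durrett comparison `p_c ≤ p⃗_c ≤ G/(5+G)`). -/
theorem criticalProb_Z5_le_2201 : criticalProb (zdGraph 5) (0 : Site 5) ≤ 0.2201 :=
  (criticalProb_le_of_checkOSM (by norm_num) (by norm_num) (by norm_num) checkOSM_5).trans (by norm_num)

/-- **`p_c^bond(ℤ^d) ≤ 0.2201` for every `d ≥ 5`.** -/
theorem criticalProb_zd_le_2201 {d : ℕ} (hd : 5 ≤ d) : criticalProb (zdGraph d) (0 : Site d) ≤ 0.2201 :=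
  (AxisGrouping.criticalProb_zd_anti hd).trans criticalProb_Z5_le_2201

end Summit.CriticalPhenomena.PercolationContinuityZ3.Theorems.Pcint.OSM

end
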